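import Summits.KontsevichZagierPeriods.KontsevichZagierPeriods.Theses.FurushoPentagon
import Literature.NumberTheory.Transcendental.KZCubicalCalculus
import Literature.NumberTheory.Transcendental.KZProductIdeal

/-!
# `ReducedPeriodRing`, line `lin-stokes-sym`: Ayoub's presentation with coordinate symmetries (definitions)

Definitions for the crux `FurushoPentagon.ReducedPeriodRing` (stmt-KontsevichZagierPeriods-3929),
line `lin-stokes-sym` (crux-strategist s1; lead c9), verbatim the vocabulary block of the registered
skeleton `Cruxes/ReducedPeriodRing/Lines/lin_stokes_sym.lean`, moved here so that the line's stub
files under `Theorems/` can import it.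

The line pins the target of the `[π]`-localisation transfer to the subgroup of `KZ.FormalRep`
generated by THREE families of moves between *tame cube* representations (domain `[0,1]ⁿ`,
integrand real-analytic near the cube, [Ayoub 2014, Def. 9–10 and Rem. 13]):
`ℚ`-linearity of the integrand (`KZ.cubicalLinGens`), Newton–Leibniz along the LAST coordinate with
an analytic `ℚ`-semialgebraic primitive (`KZ.cubicalStokesGens`), and the coordinate symmetries
`[r] − [r.reindex σ]` (`cubicalSymGens`, new here). Conjugating last-coordinate Newton–Leibniz by the
symmetries gives Ayoub's Stokes relation `∂f/∂zᵢ − f|_{zᵢ=1} + f|_{zᵢ=0}` in EVERY coordinate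
[Ayoub 2014, Def. 10], which is what the dead line `ayoub-stokes-cartier` lacked
(`Theorems/ReducedPeriodRing/Negative/KernelControlModPi.lean`).

## Main definitions (namespace `Summit.KontsevichZagierPeriods.FurushoPentagon.ReducedPeriodRing.LinStokesSym`)

* `cubicalSymGens` — `{[r] − [r.reindex σ] : r tame cube, σ ∈ Perm (Fin n)}`;
* `linStokesSymIdeal` — `closure (KZ.cubicalLinGens ∪ KZ.cubicalStokesGens ∪ cubicalSymGens)`;
* `IsKappa κ` — `κ` is the bounded arctangent kernel `[[0,1], du/((1−u)²+u²)]` (value `π/2`), the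
  localising element of the line (`[π] ∼ 2[κ]`).

## Main statements (all proved)

* `cubicalSymGens_subset_relations`, `linStokesSymIdeal_le_relations` — soundness: the three
  families are moves of the Kontsevich–Zagier calculus;
* `closure_lin_stokes_le_linStokesSymIdeal` — the dead line's ideal is contained in this one;
* `mem_cubicalSymGens` — introduction rule.

## References

* J. Ayoub, *Periods and the conjectures of Grothendieck and Kontsevich–Zagier*, EMS Newsl. 91
  (2014), Def. 9, Def. 10, Rem. 13.
* M. Kontsevich, D. Zagier, *Periods*, in: Mathematics Unlimited — 2001 and Beyond (2001), §1.1,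
  §1.2 rules (1)–(3).
-/

noncomputable section

namespace Summit.KontsevichZagierPeriods.FurushoPentagon.ReducedPeriodRing.LinStokesSym

open Set
open Literature.NumberTheory.Transcendental Literature.NumberTheory.Transcendental.KZ

/-- **Coordinate symmetries of tame cubes**: the elements `[r] − [r.reindex σ]` for a tame cube
representation `r` (domain `[0,1]ⁿ`, integrand analytic near the cube) and a permutation `σ` of the
coordinates. Conjugating Newton–Leibniz along the LAST coordinate (`KZ.cubicalStokesGens`) by these
gives Ayoub's Stokes relation `∂f/∂zᵢ − f|_{zᵢ=1} + f|_{zᵢ=0}` in every coordinate `i`.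
[Ayoub 2014, Def. 10] -/
def cubicalSymGens : Set FormalRep :=
  {c | ∃ (n : ℕ) (r : IntegralRep n) (σ : Equiv.Perm (Fin n)),
    r.domain = cube n ∧ AnalyticOnNhd ℝ r.integrand (cube n) ∧ c = of r - of (r.reindex σ)}

/-- **Ayoub's relation module with symmetries (real-analytic form)**: the subgroup of
`KZ.FormalRep` generated by `ℚ`-linearity of the integrand on a cube (`KZ.cubicalLinGens`),
Newton–Leibniz along the last coordinate with an analytic `ℚ`-semialgebraic primitive
(`KZ.cubicalStokesGens`) and the coordinate symmetries (`cubicalSymGens`). [Ayoub 2014, Def. 10] -/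
def linStokesSymIdeal : AddSubgroup FormalRep :=
  AddSubgroup.closure (KZ.cubicalLinGens ∪ KZ.cubicalStokesGens ∪ cubicalSymGens)

/-- The localising element of the line: `κ` is the bounded arctangent kernel
`[[0,1], du/((1−u)²+u²)]` (value `π/2`; `[π] − 2•[κ] ∈ KZ.relations` is the landed
`stub_piCalibration` of route HurwitzMicroSectors), pinned by domain and integrand.
[Kontsevich–Zagier 2001, §1.1] -/
def IsKappa (κ : IntegralRep 1) : Prop :=
  κ.domain = {x | x 0 ∈ Set.Icc (0:ℝ) 1} ∧ κ.integrand = (fun x => 1 / ((1 - x 0) ^ 2 + x 0 ^ 2))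

/-- Introduction rule for the symmetry generators, with tame-cube hypotheses bundled.
[Ayoub 2014, Def. 10] -/
theorem mem_cubicalSymGens {n : ℕ} {r : IntegralRep n} (hr : r.IsTameCube)
    (σ : Equiv.Perm (Fin n)) : of r - of (r.reindex σ) ∈ cubicalSymGens :=
  ⟨n, r, σ, hr.1, hr.2, rfl⟩

/-- Coordinate symmetries are change-of-variables moves of the Kontsevich–Zagier calculus
(`KZ.of_sub_of_reindex_mem_relations`: a permutation matrix, `|det| = 1`).
[Kontsevich–Zagier 2001, §1.2 rule (2)] -/
theorem cubicalSymGens_subset_relations : cubicalSymGens ⊆ (relations : Set FormalRep) := by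
  rintro c ⟨n, r, σ, -, -, rfl⟩
  exact of_sub_of_reindex_mem_relations r σ

/-- **Soundness**: `linStokesSymIdeal ≤ KZ.relations` (each family is a KZ move:
`KZ.cubicalLinGens_subset_relations`, `KZ.cubicalStokesGens_subset_relations`,
`cubicalSymGens_subset_relations`). [Ayoub 2014, Def. 10; Kontsevich–Zagier 2001, §1.2] -/
theorem linStokesSymIdeal_le_relations : linStokesSymIdeal ≤ relations := by
  refine (AddSubgroup.closure_le _).mpr ?_
  rintro x ((hx | hx) | hx)
  · exact KZ.cubicalLinGens_subset_relations hx
  · exact KZ.cubicalStokesGens_subset_relations hx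
  · exact cubicalSymGens_subset_relations hx

/-- The linearity generators lie in `linStokesSymIdeal`. [folklore] -/
theorem cubicalLinGens_subset_linStokesSymIdeal :
    KZ.cubicalLinGens ⊆ (linStokesSymIdeal : Set FormalRep) := fun _ hx =>
  AddSubgroup.subset_closure (Or.inl (Or.inl hx))

/-- The last-coordinate Newton–Leibniz generators lie in `linStokesSymIdeal`. [folklore] -/
theorem cubicalStokesGens_subset_linStokesSymIdeal :
    KZ.cubicalStokesGens ⊆ (linStokesSymIdeal : Set FormalRep) := fun _ hx =>
  AddSubgroup.subset_closure (Or.inl (Or.inr hx))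

/-- The symmetry generators lie in `linStokesSymIdeal`. [folklore] -/
theorem cubicalSymGens_subset_linStokesSymIdeal :
    cubicalSymGens ⊆ (linStokesSymIdeal : Set FormalRep) := fun _ hx =>
  AddSubgroup.subset_closure (Or.inr hx)

/-- The dead line's ideal `closure (Lin ∪ StokesLast)` (`Negative/KernelControlModPi.lean`) is
contained in this line's. [folklore] -/
theorem closure_lin_stokes_le_linStokesSymIdeal :
    AddSubgroup.closure (KZ.cubicalLinGens ∪ KZ.cubicalStokesGens) ≤ linStokesSymIdeal :=
  AddSubgroup.closure_mono Set.subset_union_left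

/-- A tame cube class and its coordinate permutation are congruent modulo `linStokesSymIdeal`.
[Ayoub 2014, Def. 10] -/
theorem of_sub_of_reindex_mem_linStokesSymIdeal {n : ℕ} {r : IntegralRep n} (hr : r.IsTameCube)
    (σ : Equiv.Perm (Fin n)) : of r - of (r.reindex σ) ∈ linStokesSymIdeal :=
  cubicalSymGens_subset_linStokesSymIdeal (mem_cubicalSymGens hr σ)

/-- Anchor of this vocabulary file for the line's stub landings (registered stub
`stub_linStokesSymIdeal_def` of crux stmt-KontsevichZagierPeriods-3929): the pinned ideal is, by
definition, the closure of the three generator families. [Ayoub 2014, Def. 10] -/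
theorem stub_linStokesSymIdeal_def :
    linStokesSymIdeal = AddSubgroup.closure (KZ.cubicalLinGens ∪ KZ.cubicalStokesGens ∪ cubicalSymGens) :=
  rfl

end Summit.KontsevichZagierPeriods.FurushoPentagon.ReducedPeriodRing.LinStokesSym
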